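import Summits.FinalStateConjecture.FinalStateConjecture.Theorems.EIHFluxBalanceInertialRecessionStubEndgameBasics

/-!
# Route EIHFluxBalance — crux `InertialRecession`, line `sublinear-is-free-clean-window-charges`:
# the endgame REDUCED TO THE PAIRWISE DICHOTOMY (every `N`)

Helper file for the crux `stmt-FinalStateConjecture-10166`
(`Summit.FinalStateConjecture.FinalStateConjecture.Theses.EIHFluxBalance.InertialRecession`), registered stub
`stub_cesaroEndgame` of the line skeleton `Cruxes/InertialRecession/Lines/sublinear-is-free-clean-window-charges.lean`.

THE REDUCTION. In the abstract setting of the endgame (smooth centres in the cone, slaved to continuous velocities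
`‖vᵢ‖ ≤ k < 1`, abstract charges obeying the WINDOW LAW and IDENTIFICATION), suppose the PAIRWISE DICHOTOMY holds:
for every pair `(i, j)`, either the two centres separate LINEARLY (`σt ≤ ‖ξⱼ − ξᵢ‖` eventually, some `σ > 0`) or their
velocities EQUALISE (`vⱼ − vᵢ → 0`). Then every velocity converges, hence every centre has a Cesàro velocity
(`exists_tendsto_velocity_of_dichotomy`, `exists_cesaro_of_dichotomy`). Proof: the class `K` of `i` under equalisation
stays within `o(t)` of `ξᵢ` (Cesàro lemma for `ξⱼ − ξᵢ`, whose derivative tends to `0`), the other centres recede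
linearly, so the window `(ξᵢ(t), c₁t)` with member set exactly `K` is admissible for all late `t`; its charge converges
(`∫^∞ s^{-3/2} < ∞`), identification gives `Σ_K Mⱼγ(vⱼ)(1, vⱼ) → (E, P)`, and equalisation inside `K` plus the Lipschitz
continuity of the Lorentz factor on `‖v‖ ≤ k` turn this into `(Σ_K Mⱼ)γ(vᵢ)(1, vᵢ) → (E, P)`, whence `vᵢ → P/E`.
What remains of the endgame after this file is the dichotomy itself (ballistic lemma for `N = 2`; cluster induction
in general). References: C. Marchal, D. Saari, J. Differential Equations 20 (1976) 150–186; D. Saari, Trans. AMS 156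
(1971) 219–240.
-/

noncomputable section

set_option linter.dupNamespace false

open Filter Topology Set MeasureTheory intervalIntegral
open scoped Topology

namespace Summit.FinalStateConjecture.FinalStateConjecture.Theorems.SublinearIsFree.Endgame

open Literature.Geometry.Lorentzian

/-- The Lorentz factor is Lipschitz on subluminal balls: `|γ(a) − γ(b)| ≤ k (1−k²)^{-3/2} ‖a − b‖` for `‖a‖, ‖b‖ ≤ k < 1`, `γ(v) = (√(1 − ‖v‖²))⁻¹`. [folklore] -/
theorem abs_lorentzFactor_sub_le {a b : E3} {k : ℝ} (hk0 : 0 ≤ k) (hk1 : k < 1) (ha : ‖a‖ ≤ k) (hb : ‖b‖ ≤ k) :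
    |(√(1 - ‖a‖ ^ 2))⁻¹ - (√(1 - ‖b‖ ^ 2))⁻¹| ≤ k / (√(1 - k ^ 2)) ^ 3 * ‖a - b‖ := by
  set m : ℝ := √(1 - k ^ 2) with hm
  have hk2 : 0 < 1 - k ^ 2 := by nlinarith
  have hmpos : 0 < m := Real.sqrt_pos.mpr hk2
  have hxa : 1 - k ^ 2 ≤ 1 - ‖a‖ ^ 2 := by nlinarith [norm_nonneg a]
  have hxb : 1 - k ^ 2 ≤ 1 - ‖b‖ ^ 2 := by nlinarith [norm_nonneg b]
  set A : ℝ := √(1 - ‖a‖ ^ 2) with hA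
  set B : ℝ := √(1 - ‖b‖ ^ 2) with hB
  have hmA : m ≤ A := Real.sqrt_le_sqrt hxa
  have hmB : m ≤ B := Real.sqrt_le_sqrt hxb
  have hApos : 0 < A := hmpos.trans_le hmA
  have hBpos : 0 < B := hmpos.trans_le hmB
  -- `A⁻¹ − B⁻¹ = (B − A)/(AB)` and `B − A = (‖a‖² − ‖b‖²)/(A + B)`
  have h1 : A⁻¹ - B⁻¹ = (B - A) / (A * B) := by
    field_simp
  have h2 : B - A = (‖a‖ ^ 2 - ‖b‖ ^ 2) / (A + B) := by
    have hAB : A + B ≠ 0 := (add_pos hApos hBpos).ne'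
    have hA2 : A ^ 2 = 1 - ‖a‖ ^ 2 := Real.sq_sqrt (by nlinarith [norm_nonneg a])
    have hB2 : B ^ 2 = 1 - ‖b‖ ^ 2 := Real.sq_sqrt (by nlinarith [norm_nonneg b])
    field_simp
    nlinarith [hA2, hB2]
  have h3 : |‖a‖ ^ 2 - ‖b‖ ^ 2| ≤ 2 * k * ‖a - b‖ := by
    have hdiff : |‖a‖ - ‖b‖| ≤ ‖a - b‖ := abs_norm_sub_norm_le a b
    have hsum : |‖a‖ + ‖b‖| ≤ 2 * k := by
      rw [abs_of_nonneg (by positivity)]; linarith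
    calc |‖a‖ ^ 2 - ‖b‖ ^ 2| = |(‖a‖ + ‖b‖) * (‖a‖ - ‖b‖)| := by ring_nf
      _ = |‖a‖ + ‖b‖| * |‖a‖ - ‖b‖| := abs_mul _ _
      _ ≤ 2 * k * ‖a - b‖ := mul_le_mul hsum hdiff (abs_nonneg _) (by positivity)
  rw [h1, h2, abs_div, abs_div, abs_of_pos (mul_pos hApos hBpos), abs_of_pos (add_pos hApos hBpos)]
  have hden1 : m * m ≤ A * B := mul_le_mul hmA hmB hmpos.le hApos.le
  have hden2 : 2 * m ≤ A + B := by linarith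
  have hm3 : 0 < m ^ 3 := pow_pos hmpos 3
  have hstep : |‖a‖ ^ 2 - ‖b‖ ^ 2| / (A + B) / (A * B) ≤ 2 * k * ‖a - b‖ / (2 * m) / (m * m) := by
    gcongr
  have heq : 2 * k * ‖a - b‖ / (2 * m) / (m * m) = k / m ^ 3 * ‖a - b‖ := by
    field_simp
  linarith [hstep, heq.le, heq.ge]

/-! ### The endgame, granted the pairwise dichotomy -/

/-- CONVERGENT VELOCITIES FROM THE PAIRWISE DICHOTOMY (abstract endgame, every `N`). See the module docstring.
[folklore] -/
theorem exists_tendsto_velocity_of_dichotomy (N : ℕ) (M : Fin N → ℝ) (ξ v : Fin N → ℝ → E3) (κ : ℝ)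
    (P : ℝ → E3 → ℝ → Fin 4 → ℝ) (hM : ∀ i, 0 < M i) (hκ0 : 0 < κ) (hκ1 : κ < 1)
    (hsmooth : ∀ i, ContDiff ℝ ((⊤ : ℕ∞) : WithTop ℕ∞) (ξ i))
    (hcone : ∀ i, ∀ᶠ t in atTop, ‖ξ i t‖ ≤ κ ^ 2 * t)
    (hk : ∃ k : ℝ, 0 ≤ k ∧ k < 1 ∧ ∀ i t, ‖v i t‖ ≤ k)
    (hslave : ∀ i, Tendsto (fun t ↦ deriv (ξ i) t - v i t) atTop (𝓝 0))
    (hWL : ∀ ρ : ℝ → ℝ, Tendsto ρ atTop atTop → ∀ δ : ℝ, 0 < δ → δ < 1 → ∃ (C T : ℝ),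
      ∀ (t₁ t₂ : ℝ) (c : ℝ → E3) (R : ℝ → ℝ), T ≤ t₁ → t₁ ≤ t₂ →
      (∀ s ∈ Set.Icc t₁ t₂, ∀ s' ∈ Set.Icc t₁ t₂, ‖c s - c s'‖ ≤ 2 * |s - s'| ∧ |R s - R s'| ≤ 2 * |s - s'|) →
      (∀ s ∈ Set.Icc t₁ t₂, ρ s ≤ δ * R s ∧ ‖c s‖ + R s ≤ (κ + κ ^ 2) / 2 * s ∧
        ∀ j, ‖ξ j s - c s‖ ≤ (1 - δ) * R s ∨ (1 + δ) * R s ≤ ‖ξ j s - c s‖) →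
      ∀ μ : Fin 4, |P t₂ (c t₂) (R t₂) μ - P t₁ (c t₁) (R t₁) μ| ≤ C * ∫ s in t₁..t₂, (R s ^ (3 / 2 : ℝ))⁻¹)
    (hID : ∀ ρ : ℝ → ℝ, Tendsto ρ atTop atTop → ∀ δ : ℝ, 0 < δ → δ < 1 → ∃ (T : ℝ) (ζ : ℝ → ℝ),
      Tendsto ζ atTop (𝓝 0) ∧ ∀ (t : ℝ) (c : E3) (R : ℝ) (A : Finset (Fin N)), T ≤ t → ρ t ≤ δ * R →
      ‖c‖ + R ≤ (κ + κ ^ 2) / 2 * t →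
      (∀ j, ‖ξ j t - c‖ ≤ (1 - δ) * R ∨ (1 + δ) * R ≤ ‖ξ j t - c‖) → (∀ j, j ∈ A ↔ ‖ξ j t - c‖ ≤ (1 - δ) * R) →
      |P t c R 0 - ∑ j ∈ A, M j * (√(1 - ‖v j t‖ ^ 2))⁻¹| ≤ ζ t ∧
      ∀ k : Fin 3, |P t c R k.succ - ∑ j ∈ A, M j * (√(1 - ‖v j t‖ ^ 2))⁻¹ * v j t k| ≤ ζ t)
    (hdich : ∀ i j : Fin N, (∃ σ : ℝ, 0 < σ ∧ ∀ᶠ t in atTop, σ * t ≤ ‖ξ j t - ξ i t‖) ∨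
      Tendsto (fun t ↦ v j t - v i t) atTop (𝓝 0))
    (i : Fin N) : ∃ V : E3, Tendsto (v i) atTop (𝓝 V) := by
  classical
  obtain ⟨k, hk0, hk1, hvk⟩ := hk
  -- the equalisation class of `i`
  set K : Finset (Fin N) := Finset.univ.filter fun j ↦ Tendsto (fun t ↦ v j t - v i t) atTop (𝓝 0) with hKdef
  have hmemK : ∀ j, j ∈ K ↔ Tendsto (fun t ↦ v j t - v i t) atTop (𝓝 0) := fun j ↦ by
    simp [hKdef]
  have hiK : i ∈ K := (hmemK i).mpr (by simp)
  -- linear separation rate of the non-members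
  have hsep : ∀ j, j ∉ K → ∃ σ : ℝ, 0 < σ ∧ ∀ᶠ t in atTop, σ * t ≤ ‖ξ j t - ξ i t‖ := fun j hj ↦
    (hdich i j).resolve_right fun h ↦ hj ((hmemK j).mpr h)
  choose! σf hσf using hsep
  set σ : ℝ := (insert (1 : ℝ) ((Finset.univ.filter fun j ↦ j ∉ K).image σf)).min' (Finset.insert_nonempty _ _)
    with hσdef
  have hσpos : 0 < σ := by
    rw [hσdef, Finset.lt_min'_iff]
    intro y hy
    rcases Finset.mem_insert.mp hy with rfl | hy
    · exact one_pos
    · obtain ⟨j, hj, rfl⟩ := Finset.mem_image.mp hy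
      exact (hσf j (Finset.mem_filter.mp hj).2).1
  have hσle : ∀ j, j ∉ K → σ ≤ σf j := fun j hj ↦
    Finset.min'_le _ _ (Finset.mem_insert_of_mem (Finset.mem_image.mpr ⟨j, Finset.mem_filter.mpr
      ⟨Finset.mem_univ _, hj⟩, rfl⟩))
  -- constants of the class window
  set c₁ : ℝ := min ((κ - κ ^ 2) / 2) (σ / 2) with hc₁
  have hκκ : 0 < κ - κ ^ 2 := by nlinarith
  have hc₁pos : 0 < c₁ := lt_min (by linarith) (by linarith)
  have hc₁le : c₁ ≤ (κ - κ ^ 2) / 2 := min_le_left _ _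
  have hc₁σ : c₁ ≤ σ / 2 := min_le_right _ _
  have hc₁two : c₁ ≤ 2 := hc₁le.trans (by nlinarith)
  -- the window law and identification at threshold `ρ = √t`, clearance `δ = 1/2`
  have hρ : Tendsto (fun t : ℝ ↦ √t) atTop atTop := by
    have := tendsto_rpow_atTop (show (0 : ℝ) < 1 / 2 by norm_num)
    refine this.congr' ?_
    filter_upwards [eventually_ge_atTop 0] with t ht
    rw [Real.sqrt_eq_rpow]
  obtain ⟨C, T_W, hW⟩ := hWL (fun t ↦ √t) hρ (1 / 2) (by norm_num) (by norm_num)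
  obtain ⟨T_I, ζ, hζ, hI⟩ := hID (fun t ↦ √t) hρ (1 / 2) (by norm_num) (by norm_num)
  -- eventual facts
  have hdiff : ∀ j, Differentiable ℝ (ξ j) := fun j ↦ (hsmooth j).differentiable (by simp)
  have hev_speed : ∀ᶠ t in atTop, ‖deriv (ξ i) t‖ ≤ 2 := by
    have h1 : ∀ᶠ t in atTop, ‖deriv (ξ i) t - v i t‖ < 1 := by
      have := (tendsto_iff_norm_sub_tendsto_zero.mp (hslave i))
      simp only [sub_zero] at this
      exact this.eventually (gt_mem_nhds (by norm_num))
    filter_upwards [h1] with t ht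
    calc ‖deriv (ξ i) t‖ = ‖(deriv (ξ i) t - v i t) + v i t‖ := by rw [sub_add_cancel]
      _ ≤ ‖deriv (ξ i) t - v i t‖ + ‖v i t‖ := norm_add_le _ _
      _ ≤ 1 + k := by linarith [hvk i t, ht.le]
      _ ≤ 2 := by linarith
  have hev_sqrt : ∀ᶠ t : ℝ in atTop, √t ≤ 1 / 2 * (c₁ * t) := by
    filter_upwards [eventually_ge_atTop (4 / c₁ ^ 2), eventually_ge_atTop (0 : ℝ)] with t ht ht0
    have hc2 : 0 < c₁ ^ 2 := by positivity
    have ht' : 4 ≤ c₁ ^ 2 * t := by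
      have := (div_le_iff₀ hc2).mp ht
      linarith
    have hy : 0 ≤ 1 / 2 * (c₁ * t) := by positivity
    have hle : t ≤ (1 / 2 * (c₁ * t)) ^ 2 := by nlinarith
    calc √t ≤ √((1 / 2 * (c₁ * t)) ^ 2) := Real.sqrt_le_sqrt hle
      _ = 1 / 2 * (c₁ * t) := Real.sqrt_sq hy
  -- members stay within `o(t)`: `(ξ j − ξ i)/t → 0` for `j ∈ K`
  have hmem_close : ∀ j, j ∈ K → ∀ᶠ t in atTop, ‖ξ j t - ξ i t‖ ≤ 1 / 2 * (c₁ * t) := by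
    intro j hj
    have hvji : Tendsto (fun t ↦ v j t - v i t) atTop (𝓝 0) := (hmemK j).mp hj
    have hder : Tendsto (deriv (fun t ↦ ξ j t - ξ i t)) atTop (𝓝 0) := by
      have hd : deriv (fun t ↦ ξ j t - ξ i t) = fun t ↦ deriv (ξ j) t - deriv (ξ i) t := by
        funext t; exact deriv_sub (hdiff j t) (hdiff i t)
      rw [hd]
      have := ((hslave j).sub (hslave i)).add hvji
      simp only [sub_zero, zero_add] at this
      refine this.congr fun t ↦ ?_
      abel
    have hces : Tendsto (fun t : ℝ ↦ t⁻¹ • (ξ j t - ξ i t)) atTop (𝓝 0) :=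
      tendsto_inv_smul_of_tendsto_deriv ((hdiff j).sub (hdiff i)) hder
    have hsmall : ∀ᶠ t : ℝ in atTop, ‖t⁻¹ • (ξ j t - ξ i t)‖ < 1 / 2 * c₁ := by
      have := (tendsto_iff_norm_sub_tendsto_zero.mp hces)
      simp only [sub_zero] at this
      exact this.eventually (gt_mem_nhds (by positivity))
    filter_upwards [hsmall, eventually_gt_atTop (0 : ℝ)] with t ht htpos
    rw [norm_smul, norm_inv, Real.norm_eq_abs, abs_of_pos htpos] at ht
    have := (inv_mul_lt_iff₀ htpos).mp ht
    linarith
  have hev_mem : ∀ᶠ t in atTop, ∀ j, j ∈ K → ‖ξ j t - ξ i t‖ ≤ 1 / 2 * (c₁ * t) := by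
    have : ∀ j, ∀ᶠ t in atTop, j ∈ K → ‖ξ j t - ξ i t‖ ≤ 1 / 2 * (c₁ * t) := fun j ↦ by
      by_cases hj : j ∈ K
      · exact (hmem_close j hj).mono fun t ht _ ↦ ht
      · exact Eventually.of_forall fun t h ↦ absurd h hj
    exact (eventually_all.mpr this).mono fun t ht j hj ↦ ht j hj
  have hev_far : ∀ᶠ t in atTop, ∀ j, j ∉ K → σ * t ≤ ‖ξ j t - ξ i t‖ := by
    have : ∀ j, ∀ᶠ t in atTop, j ∉ K → σ * t ≤ ‖ξ j t - ξ i t‖ := fun j ↦ by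
      by_cases hj : j ∈ K
      · exact Eventually.of_forall fun t h ↦ absurd hj h
      · filter_upwards [(hσf j hj).2, eventually_ge_atTop (0 : ℝ)] with t ht ht0 _
        exact (mul_le_mul_of_nonneg_right (hσle j hj) ht0).trans ht
    exact (eventually_all.mpr this).mono fun t ht j hj ↦ ht j hj
  obtain ⟨T₀, hT₀⟩ := eventually_atTop.mp
    (((((hcone i).and hev_speed).and hev_sqrt).and hev_mem).and hev_far)
  -- the master threshold
  set T : ℝ := max (max (max T₀ T_W) T_I) 1 with hTdef
  have hT0 : T₀ ≤ T := ((le_max_left _ _).trans (le_max_left _ _)).trans (le_max_left _ _)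
  have hTW : T_W ≤ T := ((le_max_right _ _).trans (le_max_left _ _)).trans (le_max_left _ _)
  have hTI : T_I ≤ T := (le_max_right _ _).trans (le_max_left _ _)
  have hTpos : 0 < T := one_pos.trans_le (le_max_right _ _)
  have hfacts : ∀ t, T ≤ t → ‖ξ i t‖ ≤ κ ^ 2 * t ∧ ‖deriv (ξ i) t‖ ≤ 2 ∧ √t ≤ 1 / 2 * (c₁ * t) ∧
      (∀ j, j ∈ K → ‖ξ j t - ξ i t‖ ≤ 1 / 2 * (c₁ * t)) ∧ (∀ j, j ∉ K → σ * t ≤ ‖ξ j t - ξ i t‖) :=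
    fun t ht ↦ by
    obtain ⟨⟨⟨⟨h1, h2⟩, h3⟩, h4⟩, h5⟩ := hT₀ t (hT0.trans ht)
    exact ⟨h1, h2, h3, h4, h5⟩
  -- admissibility of the class window `(ξ i t, c₁ t)` at every `t ≥ T`, member set exactly `K`
  have hadm : ∀ t, T ≤ t → √t ≤ 1 / 2 * (c₁ * t) ∧ ‖ξ i t‖ + c₁ * t ≤ (κ + κ ^ 2) / 2 * t ∧
      ∀ j, ‖ξ j t - ξ i t‖ ≤ (1 - 1 / 2) * (c₁ * t) ∨ (1 + 1 / 2) * (c₁ * t) ≤ ‖ξ j t - ξ i t‖ := by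
    intro t ht
    obtain ⟨hc, -, hs, hmem', hfar'⟩ := hfacts t ht
    have htpos : 0 < t := hTpos.trans_le ht
    refine ⟨hs, ?_, fun j ↦ ?_⟩
    · have : c₁ * t ≤ (κ - κ ^ 2) / 2 * t := mul_le_mul_of_nonneg_right hc₁le htpos.le
      linarith
    · by_cases hj : j ∈ K
      · left
        have := hmem' j hj
        linarith
      · right
        have h2 : c₁ * t ≤ σ / 2 * t := mul_le_mul_of_nonneg_right hc₁σ htpos.le
        have h3 : 0 ≤ σ * t := (mul_pos hσpos htpos).le
        have h1 : (1 + 1 / 2) * (c₁ * t) ≤ σ * t := by nlinarith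
        exact h1.trans (hfar' j hj)
  have hmemA : ∀ t, T ≤ t → ∀ j, j ∈ K ↔ ‖ξ j t - ξ i t‖ ≤ (1 - 1 / 2) * (c₁ * t) := by
    intro t ht j
    obtain ⟨-, -, -, hmem', hfar'⟩ := hfacts t ht
    have htpos : 0 < t := hTpos.trans_le ht
    constructor
    · intro hj; have := hmem' j hj; linarith
    · intro hle
      by_contra hj
      have h1 := hfar' j hj
      have h2 : c₁ * t ≤ σ / 2 * t := mul_le_mul_of_nonneg_right hc₁σ htpos.le
      have h3 : 0 < c₁ * t := mul_pos hc₁pos htpos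
      linarith
  -- the charge along the window path and the window law along it
  set Q : ℝ → Fin 4 → ℝ := fun t μ ↦ P t (ξ i t) (c₁ * t) μ with hQ
  have hlaw : ∀ t₁ t₂, T ≤ t₁ → t₁ ≤ t₂ → ∀ μ, |Q t₂ μ - Q t₁ μ| ≤
      C * ∫ s in t₁..t₂, ((c₁ * s) ^ (3 / 2 : ℝ))⁻¹ := by
    intro t₁ t₂ ht₁ h12 μ
    refine hW t₁ t₂ (ξ i) (fun s ↦ c₁ * s) (hTW.trans ht₁) h12 (fun s hs s' hs' ↦ ⟨?_, ?_⟩) ?_ μ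
    · have hconv : Convex ℝ (Ici T) := convex_Ici T
      have h := hconv.norm_image_sub_le_of_norm_deriv_le (f := ξ i) (fun x _ ↦ (hdiff i).differentiableAt)
        (fun x hx ↦ (hfacts x hx).2.1) (ht₁.trans hs'.1) (ht₁.trans hs.1)
      rw [← Real.norm_eq_abs]
      simpa [Real.norm_eq_abs] using h
    · rw [← mul_sub, abs_mul, abs_of_pos hc₁pos]
      exact mul_le_mul_of_nonneg_right hc₁two (abs_nonneg _)
    · intro s hs
      exact hadm s (ht₁.trans hs.1)
  have hconv : ∀ μ, ∃ L : ℝ, Tendsto (fun t ↦ Q t μ) atTop (𝓝 L) :=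
    exists_tendsto_charge_of_linear_scale (R := fun s ↦ c₁ * s) hTpos hc₁pos
      ((continuous_const.mul continuous_id).continuousOn) (fun s _ ↦ le_rfl) hlaw
  -- identification with member set `K`
  have hid : ∀ t, T ≤ t → |Q t 0 - ∑ j ∈ K, M j * (√(1 - ‖v j t‖ ^ 2))⁻¹| ≤ ζ t ∧
      ∀ kk : Fin 3, |Q t kk.succ - ∑ j ∈ K, M j * (√(1 - ‖v j t‖ ^ 2))⁻¹ * v j t kk| ≤ ζ t := by
    intro t ht
    obtain ⟨hs, hcone', hclear⟩ := hadm t ht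
    have h := hI t (ξ i t) (c₁ * t) K (hTI.trans ht) hs hcone' hclear (hmemA t ht)
    simpa [hQ] using h
  -- equalisation inside `K`: replace every `v j`, `j ∈ K`, by `v i`
  set MK : ℝ := ∑ j ∈ K, M j with hMK
  have hMKpos : 0 < MK := by
    rw [hMK, ← Finset.sum_erase_add _ _ hiK]
    exact add_pos_of_nonneg_of_pos (Finset.sum_nonneg fun j _ ↦ (hM j).le) (hM i)
  set Lγ : ℝ := k / (√(1 - k ^ 2)) ^ 3 with hLγ
  have hγlip : ∀ j t, |(√(1 - ‖v j t‖ ^ 2))⁻¹ - (√(1 - ‖v i t‖ ^ 2))⁻¹| ≤ Lγ * ‖v j t - v i t‖ :=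
    fun j t ↦ abs_lorentzFactor_sub_le hk0 hk1 (hvk j t) (hvk i t)
  have hγbd : ∀ j t, (√(1 - ‖v j t‖ ^ 2))⁻¹ ≤ (√(1 - k ^ 2))⁻¹ := fun j t ↦ by
    have hk2 : 0 < 1 - k ^ 2 := by nlinarith
    have hx : 1 - k ^ 2 ≤ 1 - ‖v j t‖ ^ 2 := by nlinarith [norm_nonneg (v j t), hvk j t]
    exact inv_anti₀ (Real.sqrt_pos.mpr hk2) (Real.sqrt_le_sqrt hx)
  -- the energy
  have hE0 : Tendsto (fun t ↦ ∑ j ∈ K, M j * (√(1 - ‖v j t‖ ^ 2))⁻¹ - MK * (√(1 - ‖v i t‖ ^ 2))⁻¹)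
      atTop (𝓝 0) := by
    have hrw : (fun t ↦ ∑ j ∈ K, M j * (√(1 - ‖v j t‖ ^ 2))⁻¹ - MK * (√(1 - ‖v i t‖ ^ 2))⁻¹) =
        fun t ↦ ∑ j ∈ K, M j * ((√(1 - ‖v j t‖ ^ 2))⁻¹ - (√(1 - ‖v i t‖ ^ 2))⁻¹) := by
      ext t; rw [hMK, Finset.sum_mul, ← Finset.sum_sub_distrib]
      refine Finset.sum_congr rfl fun j _ ↦ by ring
    rw [hrw, show (0 : ℝ) = ∑ _j ∈ K, (0 : ℝ) by simp]
    refine tendsto_finsetSum _ fun j hj ↦ ?_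
    have hvji : Tendsto (fun t ↦ v j t - v i t) atTop (𝓝 0) := (hmemK j).mp hj
    have hn := (tendsto_iff_norm_sub_tendsto_zero.mp hvji)
    simp only [sub_zero] at hn
    have hb : Tendsto (fun t ↦ M j * (Lγ * ‖v j t - v i t‖)) atTop (𝓝 0) := by
      simpa using (hn.const_mul Lγ).const_mul (M j)
    refine squeeze_zero_norm (fun t ↦ ?_) hb
    rw [Real.norm_eq_abs, abs_mul, abs_of_pos (hM j)]
    exact mul_le_mul_of_nonneg_left (hγlip j t) (hM j).le
  -- the momentum components
  have hPk : ∀ kk : Fin 3, Tendsto (fun t ↦ ∑ j ∈ K, M j * (√(1 - ‖v j t‖ ^ 2))⁻¹ * v j t kk -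
      MK * (√(1 - ‖v i t‖ ^ 2))⁻¹ * v i t kk) atTop (𝓝 0) := by
    intro kk
    have hrw : (fun t ↦ ∑ j ∈ K, M j * (√(1 - ‖v j t‖ ^ 2))⁻¹ * v j t kk -
        MK * (√(1 - ‖v i t‖ ^ 2))⁻¹ * v i t kk) =
        fun t ↦ ∑ j ∈ K, M j * ((√(1 - ‖v j t‖ ^ 2))⁻¹ * v j t kk - (√(1 - ‖v i t‖ ^ 2))⁻¹ * v i t kk) := by
      ext t; rw [hMK, Finset.sum_mul, Finset.sum_mul, ← Finset.sum_sub_distrib]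
      refine Finset.sum_congr rfl fun j _ ↦ by ring
    rw [hrw, show (0 : ℝ) = ∑ _j ∈ K, (0 : ℝ) by simp]
    refine tendsto_finsetSum _ fun j hj ↦ ?_
    have hvji : Tendsto (fun t ↦ v j t - v i t) atTop (𝓝 0) := (hmemK j).mp hj
    have hn := (tendsto_iff_norm_sub_tendsto_zero.mp hvji)
    simp only [sub_zero] at hn
    -- `γⱼ vⱼ − γᵢ vᵢ = (γⱼ − γᵢ) vⱼ + γᵢ (vⱼ − vᵢ)`
    have hb : Tendsto (fun t ↦ M j * (Lγ * ‖v j t - v i t‖ * k + (√(1 - k ^ 2))⁻¹ * ‖v j t - v i t‖))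
        atTop (𝓝 0) := by
      have h1 := (hn.const_mul Lγ).mul_const k
      have h2 := hn.const_mul (√(1 - k ^ 2))⁻¹
      simpa using ((h1.add h2).const_mul (M j))
    refine squeeze_zero_norm (fun t ↦ ?_) hb
    rw [Real.norm_eq_abs, abs_mul, abs_of_pos (hM j)]
    refine mul_le_mul_of_nonneg_left ?_ (hM j).le
    have hsplit : (√(1 - ‖v j t‖ ^ 2))⁻¹ * v j t kk - (√(1 - ‖v i t‖ ^ 2))⁻¹ * v i t kk =
        ((√(1 - ‖v j t‖ ^ 2))⁻¹ - (√(1 - ‖v i t‖ ^ 2))⁻¹) * v j t kk +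
          (√(1 - ‖v i t‖ ^ 2))⁻¹ * (v j t kk - v i t kk) := by ring
    rw [hsplit]
    have hc1 : |v j t kk| ≤ k := by
      calc |v j t kk| = ‖v j t kk‖ := (Real.norm_eq_abs _).symm
        _ ≤ ‖v j t‖ := by simpa using PiLp.norm_apply_le (v j t) kk
        _ ≤ k := hvk j t
    have hc2 : |v j t kk - v i t kk| ≤ ‖v j t - v i t‖ := by
      calc |v j t kk - v i t kk| = ‖(v j t - v i t) kk‖ := by simp [Real.norm_eq_abs]
        _ ≤ ‖v j t - v i t‖ := by simpa using PiLp.norm_apply_le (v j t - v i t) kk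
    have hγi0 : 0 ≤ (√(1 - ‖v i t‖ ^ 2))⁻¹ := inv_nonneg.mpr (Real.sqrt_nonneg _)
    calc |((√(1 - ‖v j t‖ ^ 2))⁻¹ - (√(1 - ‖v i t‖ ^ 2))⁻¹) * v j t kk +
          (√(1 - ‖v i t‖ ^ 2))⁻¹ * (v j t kk - v i t kk)|
        ≤ |((√(1 - ‖v j t‖ ^ 2))⁻¹ - (√(1 - ‖v i t‖ ^ 2))⁻¹) * v j t kk| +
          |(√(1 - ‖v i t‖ ^ 2))⁻¹ * (v j t kk - v i t kk)| := abs_add_le _ _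
      _ = |(√(1 - ‖v j t‖ ^ 2))⁻¹ - (√(1 - ‖v i t‖ ^ 2))⁻¹| * |v j t kk| +
          (√(1 - ‖v i t‖ ^ 2))⁻¹ * |v j t kk - v i t kk| := by
          rw [abs_mul, abs_mul, abs_of_nonneg hγi0]
      _ ≤ Lγ * ‖v j t - v i t‖ * k + (√(1 - k ^ 2))⁻¹ * ‖v j t - v i t‖ := by
          have hLγ0 : 0 ≤ Lγ * ‖v j t - v i t‖ := mul_nonneg (by positivity) (norm_nonneg _)
          have e1 : |(√(1 - ‖v j t‖ ^ 2))⁻¹ - (√(1 - ‖v i t‖ ^ 2))⁻¹| * |v j t kk| ≤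
              Lγ * ‖v j t - v i t‖ * k :=
            mul_le_mul (hγlip j t) hc1 (abs_nonneg _) hLγ0
          have e2 : (√(1 - ‖v i t‖ ^ 2))⁻¹ * |v j t kk - v i t kk| ≤ (√(1 - k ^ 2))⁻¹ * ‖v j t - v i t‖ :=
            mul_le_mul (hγbd i t) hc2 (abs_nonneg _) (inv_nonneg.mpr (Real.sqrt_nonneg _))
          linarith
  -- conclude with the single-body recovery at mass `MK`
  choose L hL using hconv
  have hEconv : Tendsto (fun t ↦ MK * (√(1 - ‖v i t‖ ^ 2))⁻¹) atTop (𝓝 (L 0)) := by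
    have h1 : Tendsto (fun t ↦ ∑ j ∈ K, M j * (√(1 - ‖v j t‖ ^ 2))⁻¹) atTop (𝓝 (L 0)) :=
      tendsto_of_abs_sub_le_of_tendsto (hL 0) hζ fun t ht ↦ (hid t ht).1
    have := h1.sub hE0
    simpa using this
  have hPconv : ∀ kk : Fin 3, Tendsto (fun t ↦ MK * (√(1 - ‖v i t‖ ^ 2))⁻¹ * v i t kk) atTop
      (𝓝 (L kk.succ)) := by
    intro kk
    have h1 : Tendsto (fun t ↦ ∑ j ∈ K, M j * (√(1 - ‖v j t‖ ^ 2))⁻¹ * v j t kk) atTop (𝓝 (L kk.succ)) :=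
      tendsto_of_abs_sub_le_of_tendsto (hL kk.succ) hζ fun t ht ↦ (hid t ht).2 kk
    have := h1.sub (hPk kk)
    simpa using this
  let Pv : E3 := WithLp.toLp 2 fun kk ↦ L kk.succ
  have hP' : ∀ kk : Fin 3, Tendsto (fun t ↦ MK * (√(1 - ‖v i t‖ ^ 2))⁻¹ * v i t kk) atTop (𝓝 (Pv kk)) := by
    intro kk; simpa [Pv] using hPconv kk
  exact ⟨(L 0)⁻¹ • Pv, (tendsto_velocity_of_charge hMKpos hk1 (hvk i) hEconv hP').2⟩

/-- CESÀRO VELOCITIES FROM THE PAIRWISE DICHOTOMY: under the hypotheses of `exists_tendsto_velocity_of_dichotomy`, every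
centre has a Cesàro velocity `ξᵢ(t)/t → Vᵢ` — the conclusion of the registered endgame stub, so that the stub is reduced to
the pairwise dichotomy. [folklore] -/
theorem exists_cesaro_of_dichotomy (N : ℕ) (M : Fin N → ℝ) (ξ v : Fin N → ℝ → E3) (κ : ℝ)
    (P : ℝ → E3 → ℝ → Fin 4 → ℝ) (hM : ∀ i, 0 < M i) (hκ0 : 0 < κ) (hκ1 : κ < 1)
    (hsmooth : ∀ i, ContDiff ℝ ((⊤ : ℕ∞) : WithTop ℕ∞) (ξ i))
    (hcone : ∀ i, ∀ᶠ t in atTop, ‖ξ i t‖ ≤ κ ^ 2 * t)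
    (hk : ∃ k : ℝ, 0 ≤ k ∧ k < 1 ∧ ∀ i t, ‖v i t‖ ≤ k)
    (hslave : ∀ i, Tendsto (fun t ↦ deriv (ξ i) t - v i t) atTop (𝓝 0))
    (hWL : ∀ ρ : ℝ → ℝ, Tendsto ρ atTop atTop → ∀ δ : ℝ, 0 < δ → δ < 1 → ∃ (C T : ℝ),
      ∀ (t₁ t₂ : ℝ) (c : ℝ → E3) (R : ℝ → ℝ), T ≤ t₁ → t₁ ≤ t₂ →
      (∀ s ∈ Set.Icc t₁ t₂, ∀ s' ∈ Set.Icc t₁ t₂, ‖c s - c s'‖ ≤ 2 * |s - s'| ∧ |R s - R s'| ≤ 2 * |s - s'|) →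
      (∀ s ∈ Set.Icc t₁ t₂, ρ s ≤ δ * R s ∧ ‖c s‖ + R s ≤ (κ + κ ^ 2) / 2 * s ∧
        ∀ j, ‖ξ j s - c s‖ ≤ (1 - δ) * R s ∨ (1 + δ) * R s ≤ ‖ξ j s - c s‖) →
      ∀ μ : Fin 4, |P t₂ (c t₂) (R t₂) μ - P t₁ (c t₁) (R t₁) μ| ≤ C * ∫ s in t₁..t₂, (R s ^ (3 / 2 : ℝ))⁻¹)
    (hID : ∀ ρ : ℝ → ℝ, Tendsto ρ atTop atTop → ∀ δ : ℝ, 0 < δ → δ < 1 → ∃ (T : ℝ) (ζ : ℝ → ℝ),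
      Tendsto ζ atTop (𝓝 0) ∧ ∀ (t : ℝ) (c : E3) (R : ℝ) (A : Finset (Fin N)), T ≤ t → ρ t ≤ δ * R →
      ‖c‖ + R ≤ (κ + κ ^ 2) / 2 * t →
      (∀ j, ‖ξ j t - c‖ ≤ (1 - δ) * R ∨ (1 + δ) * R ≤ ‖ξ j t - c‖) → (∀ j, j ∈ A ↔ ‖ξ j t - c‖ ≤ (1 - δ) * R) →
      |P t c R 0 - ∑ j ∈ A, M j * (√(1 - ‖v j t‖ ^ 2))⁻¹| ≤ ζ t ∧
      ∀ k : Fin 3, |P t c R k.succ - ∑ j ∈ A, M j * (√(1 - ‖v j t‖ ^ 2))⁻¹ * v j t k| ≤ ζ t)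
    (hdich : ∀ i j : Fin N, (∃ σ : ℝ, 0 < σ ∧ ∀ᶠ t in atTop, σ * t ≤ ‖ξ j t - ξ i t‖) ∨
      Tendsto (fun t ↦ v j t - v i t) atTop (𝓝 0)) :
    ∀ i, ∃ V : E3, Tendsto (fun t : ℝ ↦ t⁻¹ • ξ i t) atTop (𝓝 V) := by
  intro i
  obtain ⟨V, hV⟩ := exists_tendsto_velocity_of_dichotomy N M ξ v κ P hM hκ0 hκ1 hsmooth hcone hk hslave
    hWL hID hdich i
  exact ⟨V, tendsto_inv_smul_of_slaved ((hsmooth i).differentiable (by simp)) (hslave i) hV⟩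

/-- Registered helper form (verbatim signature) of `exists_cesaro_of_dichotomy`: the endgame reduced to the pairwise
dichotomy. [folklore] -/
theorem endgame_cesaro_of_dichotomy : open Literature.Geometry.Lorentzian Filter Topology in ∀ (N : ℕ) (M : Fin N → ℝ) (ξ v : Fin N → ℝ → E3) (κ : ℝ) (P : ℝ → E3 → ℝ → Fin 4 → ℝ), (∀ i, 0 < M i) → 0 < κ → κ < 1 → (∀ i, ContDiff ℝ ((⊤ : ℕ∞) : WithTop ℕ∞) (ξ i)) → (∀ i, ∀ᶠ t in atTop, ‖ξ i t‖ ≤ κ ^ 2 * t) → (∃ k : ℝ, 0 ≤ k ∧ k < 1 ∧ ∀ i t, ‖v i t‖ ≤ k) → (∀ i, Tendsto (fun t ↦ deriv (ξ i) t - v i t) atTop (𝓝 0)) → (∀ ρ : ℝ → ℝ, Tendsto ρ atTop atTop → ∀ δ : ℝ, 0 < δ → δ < 1 → ∃ (C T : ℝ), ∀ (t₁ t₂ : ℝ) (c : ℝ → E3) (R : ℝ → ℝ), T ≤ t₁ → t₁ ≤ t₂ → (∀ s ∈ Set.Icc t₁ t₂, ∀ s' ∈ Set.Icc t₁ t₂,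 ‖c s - c s'‖ ≤ 2 * |s - s'| ∧ |R s - R s'| ≤ 2 * |s - s'|) → (∀ s ∈ Set.Icc t₁ t₂, ρ s ≤ δ * R s ∧ ‖c s‖ + R s ≤ (κ + κ ^ 2) / 2 * s ∧ ∀ j, ‖ξ j s - c s‖ ≤ (1 - δ) * R s ∨ (1 + δ) * R s ≤ ‖ξ j s - c s‖) → ∀ μ : Fin 4, |P t₂ (c t₂) (R t₂) μ - P t₁ (c t₁) (R t₁) μ| ≤ C * ∫ s in t₁..t₂, (R s ^ (3 / 2 : ℝ))⁻¹) → (∀ ρ : ℝ → ℝ, Tendsto ρ atTop atTop → ∀ δ : ℝ, 0 < δ → δ < 1 → ∃ (T : ℝ) (ζ : ℝ → ℝ), Tendsto ζ atTop (𝓝 0) ∧ ∀ (t : ℝ) (c : E3) (R : ℝ) (A : Finset (Fin N)), T ≤ t → ρ t ≤ δ * R → ‖c‖ + R ≤ (κ + κ ^ 2) / 2 * t → (∀ j, ‖ξ j t - c‖ ≤ (1 - δ) * R ∨ (1 + δ) * R ≤ ‖ξ j t - c‖) → (∀ j, j ∈ A ↔ ‖ξ j t - c‖ ≤ (1 - δ)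 * R) → |P t c R 0 - ∑ j ∈ A, M j * (√(1 - ‖v j t‖ ^ 2))⁻¹| ≤ ζ t ∧ ∀ k : Fin 3, |P t c R k.succ - ∑ j ∈ A, M j * (√(1 - ‖v j t‖ ^ 2))⁻¹ * v j t k| ≤ ζ t) → (∀ i j : Fin N, (∃ σ : ℝ, 0 < σ ∧ ∀ᶠ t in atTop, σ * t ≤ ‖ξ j t - ξ i t‖) ∨ Tendsto (fun t ↦ v j t - v i t) atTop (𝓝 0)) → ∀ i, ∃ V : E3, Tendsto (fun t : ℝ ↦ t⁻¹ • ξ i t) atTop (𝓝 V) :=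
  fun N M ξ v κ P hM hκ0 hκ1 hsmooth hcone hk hslave hWL hID hdich ↦
    exists_cesaro_of_dichotomy N M ξ v κ P hM hκ0 hκ1 hsmooth hcone hk hslave hWL hID hdich

end Summit.FinalStateConjecture.FinalStateConjecture.Theorems.SublinearIsFree.Endgame

end
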